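import Mathlib
import Summits.Ventures.PercRepro2.SwOutAll
import Summits.Ventures.PercRepro2.SwOutSeriesDefs

/-!
# The series reduction inside an outside class, part 4: the deletion half — clusters and the class
(blind cell PercRepro2, night-4 g10, 2026-08-25; proofs/NIGHT4-G10.md §2 (b))

With exactly one edge of the series vertex open, `u` is a dead end in both colours: the deleted
graph `G − u` sees the same clusters on `V ∖ {u}` and `u` rides with the end of its open edge
(`mem_cluster_delete_iff`, `mem_cluster_delete_u_iff`, and for `ζ e₁ ≠ ζ e₂` with any recolouring of
the two loops `mem_cluster_delete_iff_of_diff`, `mem_cluster_delete_u_iff_of_diff`); the outside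
classes correspond under `ζ ↦ ζ[e₁, e₂ ↦ false]` (`mem_swOutSide_delete_iff_of_diff`).
-/

namespace Summit.Ventures.PercRepro2

namespace LocRows

open Hull

variable {V : Type*} {E : Type*} [Fintype E] [DecidableEq E]

open scoped Classical

variable {ends : E → Sym2 V} {u p q : V} {e₁ e₂ : E}

section Delete

variable (hs : IsSeriesAt ends u p q e₁ e₂) {ω : Config E} (h₁ : ω e₁ = true) (h₂ : ω e₂ = false)
include hs

omit [Fintype E] in
/-- `u` is isolated in the deleted graph. -/
lemma u_notMem_cluster_delete {x : V} (hx : x ≠ u) :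
    u ∉ cluster (deleteSeries ends u e₁ e₂) ω x := by
  intro hu
  have key : u ∈ ({v | v ≠ u} : Set V) := by
    refine mem_of_conn_of_closed (ends := deleteSeries ends u e₁ e₂) (ω := ω) ?_ hx hu
    intro a ha b hab
    obtain ⟨hne, e, _, hends⟩ := openGraph_adj.1 hab
    by_cases he₁ : e = e₁
    · subst he₁
      rw [deleteSeries_apply_e₁, Sym2.eq_iff] at hends
      exact absurd (by rcases hends with ⟨h, h'⟩ | ⟨h, h'⟩ <;> first | exact h.symm.trans h' | exact h'.symm.trans h) hne
    by_cases he₂ : e = e₂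
    · subst he₂
      rw [deleteSeries_apply_e₂ hs.ne, Sym2.eq_iff] at hends
      exact absurd (by rcases hends with ⟨h, h'⟩ | ⟨h, h'⟩ <;> first | exact h.symm.trans h' | exact h'.symm.trans h) hne
    · rw [deleteSeries_apply_of_ne he₁ he₂] at hends
      exact ne_u_of_mem_ends hs he₁ he₂ (by rw [hends]; exact Sym2.mem_mk_right a b)
  exact key rfl

omit [Fintype E] in
/-- A cluster of the deleted graph lies in the cluster of the original graph. -/
lemma cluster_delete_subset (x : V) :
    cluster (deleteSeries ends u e₁ e₂) ω x ⊆ cluster ends ω x := by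
  intro v hv
  refine mem_of_conn_of_closed (ends := deleteSeries ends u e₁ e₂) (ω := ω)
    (S := cluster ends ω x) ?_ (mem_cluster_self _ _ _) hv
  intro a ha b hab
  obtain ⟨hne, e, he, hends⟩ := openGraph_adj.1 hab
  by_cases he₁ : e = e₁
  · subst he₁
    rw [deleteSeries_apply_e₁, Sym2.eq_iff] at hends
    exact absurd (by rcases hends with ⟨h, h'⟩ | ⟨h, h'⟩ <;> first | exact h.symm.trans h' | exact h'.symm.trans h) hne
  by_cases he₂ : e = e₂
  · subst he₂
    rw [deleteSeries_apply_e₂ hs.ne, Sym2.eq_iff] at hends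
    exact absurd (by rcases hends with ⟨h, h'⟩ | ⟨h, h'⟩ <;> first | exact h.symm.trans h' | exact h'.symm.trans h) hne
  · rw [deleteSeries_apply_of_ne he₁ he₂] at hends
    exact mem_cluster_of_edge ha he hends

include h₁ h₂

omit [Fintype E] in
/-- The cluster of the original graph lies in the deleted cluster, plus `u` when `p` is there. -/
lemma cluster_subset_delete {x : V} (hx : x ≠ u) :
    cluster ends ω x ⊆
      cluster (deleteSeries ends u e₁ e₂) ω x ∪
        {v | v = u ∧ p ∈ cluster (deleteSeries ends u e₁ e₂) ω x} := by
  intro v hv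
  refine mem_of_conn_of_closed (ends := ends) (ω := ω) ?_ (Or.inl (mem_cluster_self _ _ _)) hv
  intro a ha b hab
  obtain ⟨hne, e, he, hends⟩ := openGraph_adj.1 hab
  have hS : ∀ w, w ≠ u → w ∈ cluster (deleteSeries ends u e₁ e₂) ω x ∪
      {v | v = u ∧ p ∈ cluster (deleteSeries ends u e₁ e₂) ω x} →
      w ∈ cluster (deleteSeries ends u e₁ e₂) ω x := by
    intro w hw hwS
    rcases hwS with h | ⟨rfl, _⟩
    · exact h
    · exact absurd rfl hw
  by_cases he₁ : e = e₁
  · subst he₁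
    rw [hs.ends₁, Sym2.eq_iff] at hends
    rcases hends with ⟨rfl, rfl⟩ | ⟨rfl, rfl⟩
    · rcases ha with h | ⟨_, hp⟩
      · exact absurd h (u_notMem_cluster_delete hs hx)
      · exact Or.inl hp
    · exact Or.inr ⟨rfl, hS _ hs.up.symm ha⟩
  by_cases he₂ : e = e₂
  · subst he₂
    rw [h₂] at he
    exact absurd he (by decide)
  · have hau : a ≠ u := ne_u_of_mem_ends hs he₁ he₂ (by rw [hends]; exact Sym2.mem_mk_left a b)
    have ha' := hS a hau ha
    refine Or.inl (mem_cluster_of_edge ha' he ?_)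
    rw [deleteSeries_apply_of_ne he₁ he₂]
    exact hends

omit [Fintype E] in
/-- **Deletion keeps the clusters on `V ∖ {u}`** (one edge open, the other closed). -/
theorem mem_cluster_delete_iff {x v : V} (hx : x ≠ u) (hv : v ≠ u) :
    v ∈ cluster ends ω x ↔ v ∈ cluster (deleteSeries ends u e₁ e₂) ω x := by
  constructor
  · intro h
    rcases cluster_subset_delete hs h₁ h₂ hx h with h' | ⟨rfl, _⟩
    · exact h'
    · exact absurd rfl hv
  · exact fun h => cluster_delete_subset hs x h

omit [Fintype E] in
/-- **`u` rides with the end of its open edge under deletion.** -/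
theorem mem_cluster_delete_u_iff {x : V} (hx : x ≠ u) :
    u ∈ cluster ends ω x ↔ p ∈ cluster (deleteSeries ends u e₁ e₂) ω x := by
  constructor
  · intro h
    rcases cluster_subset_delete hs h₁ h₂ hx h with h' | ⟨_, hp⟩
    · exact absurd h' (u_notMem_cluster_delete hs hx)
    · exact hp
  · intro hp
    have hp' : p ∈ cluster ends ω x := cluster_delete_subset hs x hp
    exact mem_cluster_of_edge hp' h₁ (ends_swap hs.ends₁)

end Delete

section DeleteClass

variable (hs : IsSeriesAt ends u p q e₁ e₂)
include hs

omit [Fintype E] in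
/-- For a configuration with `ζ e₁ ≠ ζ e₂`, membership of a vertex `v ≠ u` in a cluster of `x ≠ u` is
the same in `G` and in `G − u` (for any recolouring of the two loops). -/
theorem mem_cluster_delete_iff_of_diff {ζ : Config E} (hdiff : ζ e₁ ≠ ζ e₂) (b₁ b₂ : Bool) {x v : V}
    (hx : x ≠ u) (hv : v ≠ u) :
    v ∈ cluster ends ζ x ↔
      v ∈ cluster (deleteSeries ends u e₁ e₂)
        (Function.update (Function.update ζ e₂ b₂) e₁ b₁) x := by
  rw [cluster_update_of_loop (deleteSeries_apply_e₁ (ends := ends) (u := u) (e₂ := e₂)),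
    cluster_update_of_loop (deleteSeries_apply_e₂ (ends := ends) (u := u) hs.ne)]
  cases h₁ : ζ e₁ with
  | true =>
    have h₂ : ζ e₂ = false := by
      cases h₂ : ζ e₂
      · rfl
      · exact absurd (h₁.trans h₂.symm) hdiff
    exact mem_cluster_delete_iff hs h₁ h₂ hx hv
  | false =>
    have h₂ : ζ e₂ = true := by
      cases h₂ : ζ e₂
      · exact absurd (h₁.trans h₂.symm) hdiff
      · rfl
    rw [deleteSeries_comm hs.ne]
    exact mem_cluster_delete_iff hs.symm h₂ h₁ hx hv

omit [Fintype E] in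
/-- `u` rides with the end of its open edge. -/
theorem mem_cluster_delete_u_iff_of_diff {ζ : Config E} (hdiff : ζ e₁ ≠ ζ e₂) (b₁ b₂ : Bool) {x : V}
    (hx : x ≠ u) :
    u ∈ cluster ends ζ x ↔
      ((ζ e₁ = true ∧ p ∈ cluster (deleteSeries ends u e₁ e₂)
          (Function.update (Function.update ζ e₂ b₂) e₁ b₁) x) ∨
        (ζ e₂ = true ∧ q ∈ cluster (deleteSeries ends u e₁ e₂)
          (Function.update (Function.update ζ e₂ b₂) e₁ b₁) x)) := by
  rw [cluster_update_of_loop (deleteSeries_apply_e₁ (ends := ends) (u := u) (e₂ := e₂)),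
    cluster_update_of_loop (deleteSeries_apply_e₂ (ends := ends) (u := u) hs.ne)]
  cases h₁ : ζ e₁ with
  | true =>
    have h₂ : ζ e₂ = false := by
      cases h₂ : ζ e₂
      · rfl
      · exact absurd (h₁.trans h₂.symm) hdiff
    simp only [h₂, Bool.false_eq_true, false_and, or_false, true_and]
    exact mem_cluster_delete_u_iff hs h₁ h₂ hx
  | false =>
    have h₂ : ζ e₂ = true := by
      cases h₂ : ζ e₂
      · exact absurd (h₁.trans h₂.symm) hdiff
      · rfl
    simp only [h₂, Bool.false_eq_true, false_and, false_or, true_and]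
    rw [deleteSeries_comm hs.ne]
    exact mem_cluster_delete_u_iff hs.symm h₂ h₁ hx

omit [Fintype E] in
/-- The edges touching `U ∖ {u}` in `G − u` are the edges touching `U` in `G` other than `e₁, e₂`. -/
lemma mem_touches_delete_iff {U : Set V} {e : E} :
    e ∈ touches (deleteSeries ends u e₁ e₂) (U \ {u}) ↔
      e ∈ touches ends U ∧ e ≠ e₁ ∧ e ≠ e₂ := by
  by_cases he₁ : e = e₁
  · subst e
    simp only [ne_eq, not_true_eq_false, false_and, and_false, iff_false]
    rintro ⟨x, hx, y, hxy⟩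
    rw [deleteSeries_apply_e₁, Sym2.eq_iff] at hxy
    rcases hxy with ⟨rfl, _⟩ | ⟨_, rfl⟩ <;> exact hx.2 rfl
  by_cases he₂ : e = e₂
  · subst e
    simp only [ne_eq, not_true_eq_false, and_false, iff_false]
    rintro ⟨x, hx, y, hxy⟩
    rw [deleteSeries_apply_e₂ hs.ne, Sym2.eq_iff] at hxy
    rcases hxy with ⟨rfl, _⟩ | ⟨_, rfl⟩ <;> exact hx.2 rfl
  · simp only [ne_eq, he₁, not_false_eq_true, he₂, and_true]
    constructor
    · rintro ⟨x, hx, y, hxy⟩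
      rw [deleteSeries_apply_of_ne he₁ he₂] at hxy
      exact ⟨x, hx.1, y, hxy⟩
    · rintro ⟨x, hx, y, hxy⟩
      have hxu : x ≠ u := ne_u_of_mem_ends hs he₁ he₂ (by rw [hxy]; exact Sym2.mem_mk_left x y)
      exact ⟨x, ⟨hx, hxu⟩, y, by rw [deleteSeries_apply_of_ne he₁ he₂]; exact hxy⟩

/-- **The class correspondence of the deletion**: a configuration with `ζ e₁ ≠ ζ e₂` lies in the
outside class of `(G, U, ξ)` iff its canonical image (both loops recoloured `false`) lies in the
outside class of `(G − u, U ∖ {u}, ξ[e₁, e₂ ↦ false])`. -/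
theorem mem_swOutSide_delete_iff_of_diff {U : Set V} {ξ : Config E} {l h o : V} (hu : u ∈ U)
    (huh : u ≠ h) (hul : u ≠ l) (huo : u ≠ o) {ζ : Config E} (hdiff : ζ e₁ ≠ ζ e₂) :
    ζ ∈ swOutSide ends l h o U ξ ↔
      Function.update (Function.update ζ e₂ false) e₁ false ∈
        swOutSide (deleteSeries ends u e₁ e₂) l h o (U \ {u})
          (Function.update (Function.update ξ e₂ false) e₁ false) := by
  have hdiff' : blue ζ e₁ ≠ blue ζ e₂ := by
    simp only [blue]; intro h'; exact hdiff (by simpa using h')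
  have hblue : blue (Function.update (Function.update ζ e₂ false) e₁ false) =
      Function.update (Function.update (blue ζ) e₂ true) e₁ true := by
    rw [blue_update, blue_update]; rfl
  have hA : ∀ v, v ≠ u → (v ∈ cluster ends ζ l ↔
      v ∈ cluster (deleteSeries ends u e₁ e₂)
        (Function.update (Function.update ζ e₂ false) e₁ false) l) :=
    fun v hv => mem_cluster_delete_iff_of_diff hs hdiff false false hul.symm hv
  have hB : ∀ v, v ≠ u → (v ∈ cluster ends (blue ζ) l ↔
      v ∈ cluster (deleteSeries ends u e₁ e₂)
        (blue (Function.update (Function.update ζ e₂ false) e₁ false)) l) := by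
    intro v hv
    rw [hblue]
    exact mem_cluster_delete_iff_of_diff hs hdiff' true true hul.symm hv
  have hT : ∀ v, v ≠ u → (v ∈ cluster ends ζ h ↔
      v ∈ cluster (deleteSeries ends u e₁ e₂)
        (Function.update (Function.update ζ e₂ false) e₁ false) h) :=
    fun v hv => mem_cluster_delete_iff_of_diff hs hdiff false false huh.symm hv
  have hT' : ∀ v, v ≠ u → (v ∈ cluster ends (blue ζ) h ↔
      v ∈ cluster (deleteSeries ends u e₁ e₂)
        (blue (Function.update (Function.update ζ e₂ false) e₁ false)) h) := by
    intro v hv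
    rw [hblue]
    exact mem_cluster_delete_iff_of_diff hs hdiff' true true huh.symm hv
  have he₁U : e₁ ∈ touches ends U := ⟨u, hu, p, hs.ends₁⟩
  have he₂U : e₂ ∈ touches ends U := ⟨u, hu, q, hs.ends₂⟩
  rw [mem_swOutSide, mem_swOutSide, mem_outClass, mem_outClass]
  simp only [tgtU, Finset.mem_filter, Finset.mem_univ, true_and, Set.mem_setOf_eq, hull,
    Set.mem_union, not_or]
  constructor
  · rintro ⟨⟨⟨hhA, hhB⟩, hoA, hoB⟩, hpin, hhull⟩
    refine ⟨⟨⟨?_, ?_⟩, ?_, ?_⟩, ?_, ?_⟩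
    · exact fun h' => hhA ((hA h huh.symm).2 h')
    · exact fun h' => hhB ((hB h huh.symm).2 h')
    · exact (hA o huo.symm).1 hoA
    · exact fun h' => hoB ((hB o huo.symm).2 h')
    · intro e he
      rw [mem_touches_delete_iff hs] at he
      by_cases he₁ : e = e₁
      · subst e; simp
      by_cases he₂ : e = e₂
      · subst e; simp [Function.update_of_ne hs.ne.symm]
      · have heU : e ∉ touches ends U := fun h' => he ⟨h', he₁, he₂⟩
        rw [Function.update_of_ne he₁, Function.update_of_ne he₂, Function.update_of_ne he₁,
          Function.update_of_ne he₂]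
        exact hpin e heU
    · intro v hv
      have hvu : v ≠ u := by
        rintro rfl
        rcases hv with hv | hv
        · exact u_notMem_cluster_delete hs huh.symm hv
        · exact u_notMem_cluster_delete hs huh.symm hv
      refine ⟨hhull ?_, hvu⟩
      rcases hv with hv | hv
      · exact Or.inl ((hT v hvu).2 hv)
      · exact Or.inr ((hT' v hvu).2 hv)
  · rintro ⟨⟨⟨hhA, hhB⟩, hoA, hoB⟩, hpin, hhull⟩
    refine ⟨⟨⟨?_, ?_⟩, ?_, ?_⟩, ?_, ?_⟩
    · exact fun h' => hhA ((hA h huh.symm).1 h')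
    · exact fun h' => hhB ((hB h huh.symm).1 h')
    · exact (hA o huo.symm).2 hoA
    · exact fun h' => hoB ((hB o huo.symm).1 h')
    · intro e he
      have he₁ : e ≠ e₁ := by rintro rfl; exact he he₁U
      have he₂ : e ≠ e₂ := by rintro rfl; exact he he₂U
      have he' : e ∉ touches (deleteSeries ends u e₁ e₂) (U \ {u}) := by
        rw [mem_touches_delete_iff hs]; exact fun h' => he h'.1
      have := hpin e he'
      rwa [Function.update_of_ne he₁, Function.update_of_ne he₂, Function.update_of_ne he₁,
        Function.update_of_ne he₂] at this
    · intro v hv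
      by_cases hvu : v = u
      · exact hvu ▸ hu
      · refine (hhull ?_).1
        rcases hv with hv | hv
        · exact Or.inl ((hT v hvu).1 hv)
        · exact Or.inr ((hT' v hvu).1 hv)

end DeleteClass

end LocRows

end Summit.Ventures.PercRepro2
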